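import Summits.Ventures.YMGap.YM4Door.WilsonPrice
import Literature.MathematicalPhysics.QuantumFieldTheory.Balaban1983to89.CrossoverLedger
import Literature.MathematicalPhysics.QuantumLattice.LatticeGaugeDLRCovarianceSplit

/-!
# YM4Door / BlockTransport — observable transport through Bałaban's block map: the law of total covariance through a
# blocking, the push-forward of the fine Wilson state, the transport inequality, the uniform (T1)+(T2) packaging

HONEST FRAMING (cell `ym-beyond`, seat P2 «strong-coupling bridge», HUMAN RULING D-0035 / D-0037; tree edition, g8,
2026-08-25, of the farm-checked HOME sketch `HOME/ROUTE-P2-SketchTransport.lean` v0.3 sha16 6ca874c045b38eb5 —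
namespace `YMBeyond.P2.Transport` → `Summit.Ventures.YMGap.YM4Door`, the abbreviation `SU2.ρ2` now imported from
`YM4Door/StripDoor.lean`; memo `HOME/ROUTE-P2.md` §4b, §5; referee baseline v0.7 PASS).  LATTICE / finite-torus
bookkeeping only: nothing here is a continuum, spectral or Clay-sense statement; nothing here is a part of Bałaban's
theorems; the two transport inputs (T1) `FluctuationDecorrelationU` and (T2) `CondExpLocalityU` are TYPED, never
asserted.  This file makes precise the one node of the Y2 bridge that is NOT a statement about effective actions alone —
«fine observables cluster because the blocked theory clusters» — by splitting it into two renormalisation-group-native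
statements and PROVING the glue.  NO conjecture name, NO `sorry`, NO axiom beyond the standard three; label K.

* §A (abstract probability, proved): the LAW OF TOTAL COVARIANCE THROUGH A MEASURABLE MAP `π`.  If `f_A ∘ π` is a version
  of `E_μ[A | π]` (`IsBlockVersion`: orthogonality to bounded measurable functions of `π`) and likewise for `B`, then
  `cov_μ[A, B] = cov_μ[A − f_A∘π, B − f_B∘π] + cov_{π_* μ}[f_A, f_B]` (`covariance_split`); the cheap bound
  `|cov[u, v]| ≤ 2 ε M` for `|u| ≤ ε`, `|v| ≤ M` (`abs_covariance_le_of_bounds`); and the MULTISCALE (martingale) form along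
  a tower of blockings `P j` (`covariance_tower_split`): `cov_μ[A, B] = Σ_{j<k} cov_μ[D_j A, D_j B] + cov_{(P_k)_*μ}[f_k, g_k]`.
* §B (tree objects, proved): for a Bałaban effective action `𝓔` OF lattice Yang–Mills at `β` blocked through `B`
  (`IsBalabanEffectiveActionOf ρ B β 𝓔`, Literature `BlockScaleEffectivePerturbation`), the push-forward of the fine WILSON
  PROBABILITY measure along the block map is the perturbed measure of the effective action:
  `(wilsonMeasure ρ β).map B.link = 𝓔.terms.perturbedMeasure ρ 𝓔.β` (`map_link_wilsonMeasure`; the partition functions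
  agree because blocking loses no mass, `partitionFunction_terms_eq`), hence `cov_fine[f∘B.link, g∘B.link] = cov_eff[f, g]`
  (`covariance_comp_link`) and the blocked theory is a probability measure (`isProbabilityMeasure_perturbedMeasure_of`).
* §C (proved): the TRANSPORT INEQUALITY on one fine torus of side `b·S`:
  `|cov_fine[A, B]| ≤ ε_T1 + 2(ε_A M_B + M_A ε_B) + A_cl (Σδ_B)(Σδ_A) e^{−m n}` from (T1) a fluctuation-covariance bound,
  (T2) sup-approximation of the block versions by finite-range Lipschitz cylinder observables of the block field with
  supports `n` apart, and the door's `ClustersWith 𝓔.terms 𝓔.β A_cl m` (`transport_inequality`).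
* §D (typed, glue proved): the uniform packaging over a fixed BLOCKING SCHEME `𝔅 b S : GaugeBlockAveraging 4 G b S` —
  `FluctuationDecorrelationU` (T1), `CondExpLocalityU` (T2), `SU2.AtTorusDoor`, `DoorRegime`, `HandOverOnBlockTori` — and
  `handOverOnBlockTori_of_split`: (T1) ∧ (T2) ∧ H-b at the door ⇒ clustering of every pair of bounded measurable fine
  observables admitting such data, on the block-commensurate fine tori `b·S`.  The remaining distance to a conclusion on
  ALL tori / all species (cofinality, volume interpolation; memo W5) is NOT hidden here.

NOT HERE: the door cells and the strip door (`YM4Door/StripDoor.lean`); the Haar form and the door-condition glue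
(`YM4Door/HaarForm.lean`); the Y2 bridge that consumes `HandOverOnBlockTori` (summit side).

References: T. Bałaban, CMP 119 (1988) §2 (2.23) [Balaban1988Convergent]; CMP 98 (1985) 17–51 (averaging operations)
[Balaban1985Averaging]; H. Föllmer, LNM 1362 (1988) Ch. I; D. Williams, Probability with Martingales (1991) §9 (tower
property); the tree files named above.

THIS MODULE: §A–§C (abstract probability, the block push-forward, the transport inequality); §D and the `SU(2)` packaging are
`YM4Door/SpeciesTransport.lean` (split for the gate's 400-line limit; one text, g8).
-/

set_option autoImplicit false

noncomputable section

open MeasureTheory ProbabilityTheory Finset Function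
open Literature.Probability.LatticeModels Literature.Probability.LatticeModels.DobrushinMetric
open Literature.MathematicalPhysics.QuantumLattice hiding torusNorm configShift
open Literature.MathematicalPhysics.QuantumFieldTheory hiding ZdEdge
open Summit.Ventures.YMGap.RobustBall

namespace Summit.Ventures.YMGap.YM4Door

/-! ## §A  Abstract probability: total covariance through a map, cheap covariance bounds -/

section Abstract

variable {Ω Ω' : Type*} [MeasurableSpace Ω] [MeasurableSpace Ω'] {μ : Measure Ω}

/-- A measurable function with a uniform bound is in `L²` of a finite measure. -/
theorem memLp_two_of_abs_le [IsFiniteMeasure μ] {f : Ω → ℝ} (hf : Measurable f) {M : ℝ}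
    (hM : ∀ ω, |f ω| ≤ M) : MemLp f 2 μ :=
  MemLp.of_bound hf.aestronglyMeasurable M (ae_of_all _ fun ω => by simpa [Real.norm_eq_abs] using hM ω)

/-- A measurable function with a uniform bound is integrable against a finite measure. -/
theorem integrable_of_abs_le [IsFiniteMeasure μ] {f : Ω → ℝ} (hf : Measurable f) {M : ℝ}
    (hM : ∀ ω, |f ω| ≤ M) : Integrable f μ :=
  Integrable.of_bound hf.aestronglyMeasurable M (ae_of_all _ fun ω => by simpa [Real.norm_eq_abs] using hM ω)

/-- Averages of a function bounded by `M` against a probability measure are bounded by `M`. -/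
theorem abs_integral_le_of_abs_le [IsProbabilityMeasure μ] {f : Ω → ℝ} {M : ℝ} (hM : ∀ ω, |f ω| ≤ M) :
    |∫ ω, f ω ∂μ| ≤ M := by
  have h := norm_integral_le_of_norm_le_const (μ := μ) (f := f) (C := M)
    (ae_of_all _ fun ω => by simpa [Real.norm_eq_abs] using hM ω)
  simpa [Real.norm_eq_abs] using h

/-- **Cheap covariance bound**: `|cov[u, v]| ≤ 2 ε M` when `|u| ≤ ε` and `|v| ≤ M` pointwise. -/
theorem abs_covariance_le_of_bounds [IsProbabilityMeasure μ] {u v : Ω → ℝ} (hu : Measurable u)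
    (hv : Measurable v) {ε M : ℝ} (hε : ∀ ω, |u ω| ≤ ε) (hM : ∀ ω, |v ω| ≤ M) :
    |cov[u, v; μ]| ≤ 2 * ε * M := by
  obtain ⟨ω₀⟩ := nonempty_of_isProbabilityMeasure μ
  have hε0 : 0 ≤ ε := (abs_nonneg _).trans (hε ω₀)
  have hM0 : 0 ≤ M := (abs_nonneg _).trans (hM ω₀)
  rw [covariance_eq_sub (memLp_two_of_abs_le hu hε) (memLp_two_of_abs_le hv hM)]
  have h1 : |∫ ω, (u * v) ω ∂μ| ≤ ε * M := abs_integral_le_of_abs_le fun ω => by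
    rw [Pi.mul_apply, abs_mul]; exact mul_le_mul (hε ω) (hM ω) (abs_nonneg _) hε0
  have h2 : |(∫ ω, u ω ∂μ) * ∫ ω, v ω ∂μ| ≤ ε * M := by
    rw [abs_mul]
    exact mul_le_mul (abs_integral_le_of_abs_le hε) (abs_integral_le_of_abs_le hM) (abs_nonneg _) hε0
  calc |(∫ ω, (u * v) ω ∂μ) - (∫ ω, u ω ∂μ) * ∫ ω, v ω ∂μ|
      ≤ |∫ ω, (u * v) ω ∂μ| + |(∫ ω, u ω ∂μ) * ∫ ω, v ω ∂μ| := abs_sub _ _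
    _ ≤ ε * M + ε * M := add_le_add h1 h2
    _ = 2 * ε * M := by ring

/-- **`f ∘ π` is a version of the conditional expectation `E_μ[A | π]`**: `A − f∘π` is orthogonal in
`L²(μ)` to every bounded measurable function of `π` (for bounded measurable `A`, `f` this is equivalent to
`μ[A | σ(π)] = f ∘ π` a.e.; the orthogonality form is what the covariance algebra consumes). -/
@[folklore] def IsBlockVersion (μ : Measure Ω) (π : Ω → Ω') (A : Ω → ℝ) (f : Ω' → ℝ) : Prop :=
  ∀ h : Ω' → ℝ, Measurable h → (∃ M, ∀ x, |h x| ≤ M) → ∫ ω, (A ω - f (π ω)) * h (π ω) ∂μ = 0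

namespace IsBlockVersion

variable {π : Ω → Ω'} {A : Ω → ℝ} {f : Ω' → ℝ}

/-- The fluctuation part has mean zero. -/
theorem integral_sub_eq_zero (hv : IsBlockVersion μ π A f) : ∫ ω, (A ω - f (π ω)) ∂μ = 0 := by
  simpa using hv (fun _ => 1) measurable_const ⟨1, fun _ => by simp⟩

/-- The fluctuation part is uncorrelated with every bounded measurable function of the block variable. -/
theorem covariance_eq_zero [IsProbabilityMeasure μ] (hv : IsBlockVersion μ π A f) (hπ : Measurable π)
    (hA : Measurable A) (hf : Measurable f) {MA Mf : ℝ} (hAb : ∀ ω, |A ω| ≤ MA) (hfb : ∀ x, |f x| ≤ Mf)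
    {h : Ω' → ℝ} (hh : Measurable h) {Mh : ℝ} (hhb : ∀ x, |h x| ≤ Mh) :
    cov[fun ω => A ω - f (π ω), fun ω => h (π ω); μ] = 0 := by
  have hfl : Measurable fun ω => A ω - f (π ω) := hA.sub (hf.comp hπ)
  have hflb : ∀ ω, |A ω - f (π ω)| ≤ MA + Mf := fun ω =>
    (abs_sub _ _).trans (add_le_add (hAb ω) (hfb _))
  have lh : MemLp (fun ω => h (π ω)) 2 μ := memLp_two_of_abs_le (f := fun ω => h (π ω)) (hh.comp hπ) fun ω => hhb _
  rw [covariance_eq_sub (memLp_two_of_abs_le hfl hflb) lh]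
  have h1 : ∫ ω, ((fun ω => A ω - f (π ω)) * fun ω => h (π ω)) ω ∂μ = 0 := by
    simpa [Pi.mul_apply] using hv h hh ⟨Mh, hhb⟩
  rw [h1, hv.integral_sub_eq_zero, zero_mul, sub_zero]

end IsBlockVersion

/-- **Law of total covariance through a measurable map** (block field `π`): for bounded measurable `A, B` with
block versions `f_A, f_B`,
`cov_μ[A, B] = cov_μ[A − f_A∘π, B − f_B∘π] + cov_{π_*μ}[f_A, f_B]` — «fine covariance = fluctuation covariance
+ covariance of the conditional expectations under the BLOCKED measure». -/
theorem covariance_split [IsProbabilityMeasure μ] {π : Ω → Ω'} (hπ : Measurable π) {A B : Ω → ℝ}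
    {fA fB : Ω' → ℝ} (hAm : Measurable A) (hBm : Measurable B) (hfAm : Measurable fA) (hfBm : Measurable fB)
    {MA MB MfA MfB : ℝ} (hAb : ∀ ω, |A ω| ≤ MA) (hBb : ∀ ω, |B ω| ≤ MB) (hfAb : ∀ x, |fA x| ≤ MfA)
    (hfBb : ∀ x, |fB x| ≤ MfB) (hvA : IsBlockVersion μ π A fA) (hvB : IsBlockVersion μ π B fB) :
    cov[A, B; μ] =
      cov[fun ω => A ω - fA (π ω), fun ω => B ω - fB (π ω); μ] + cov[fA, fB; μ.map π] := by
  -- the four pieces are in L²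
  have lA' : MemLp (fun ω => A ω - fA (π ω)) 2 μ :=
    memLp_two_of_abs_le (hAm.sub (hfAm.comp hπ)) fun ω => (abs_sub _ _).trans (add_le_add (hAb ω) (hfAb _))
  have lB' : MemLp (fun ω => B ω - fB (π ω)) 2 μ :=
    memLp_two_of_abs_le (hBm.sub (hfBm.comp hπ)) fun ω => (abs_sub _ _).trans (add_le_add (hBb ω) (hfBb _))
  have lfA : MemLp (fun ω => fA (π ω)) 2 μ := memLp_two_of_abs_le (hfAm.comp hπ) fun ω => hfAb _
  have lfB : MemLp (fun ω => fB (π ω)) 2 μ := memLp_two_of_abs_le (hfBm.comp hπ) fun ω => hfBb _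
  have hA : A = (fun ω => A ω - fA (π ω)) + fun ω => fA (π ω) := by funext ω; simp
  have hB : B = (fun ω => B ω - fB (π ω)) + fun ω => fB (π ω) := by funext ω; simp
  -- cross terms vanish
  have c1 : cov[fun ω => A ω - fA (π ω), fun ω => fB (π ω); μ] = 0 :=
    hvA.covariance_eq_zero hπ hAm hfAm hAb hfAb hfBm hfBb
  have c2 : cov[fun ω => fA (π ω), fun ω => B ω - fB (π ω); μ] = 0 := by
    rw [covariance_comm]; exact hvB.covariance_eq_zero hπ hBm hfBm hBb hfBb hfAm hfAb
  -- the block term is a covariance under the push-forward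
  have c3 : cov[fun ω => fA (π ω), fun ω => fB (π ω); μ] = cov[fA, fB; μ.map π] :=
    (covariance_map_fun hfAm.aestronglyMeasurable hfBm.aestronglyMeasurable hπ.aemeasurable).symm
  conv_lhs => rw [hA, hB]
  rw [covariance_add_left lA' lfA (lB'.add lfB), covariance_add_right lA' lB' lfB,
    covariance_add_right lfA lB' lfB, c1, c2, c3]
  ring

/-- **Approximation step**: replacing `f, g` by sup-approximants `f', g'` changes the covariance by at most
`2(ε_f M_g + M_{f'} ε_g)`. -/
theorem abs_covariance_sub_covariance_le [IsProbabilityMeasure μ] {f g f' g' : Ω → ℝ} (hf : Measurable f)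
    (hg : Measurable g) (hf' : Measurable f') (hg' : Measurable g') {Mf Mg Mf' Mg' εf εg : ℝ}
    (hfb : ∀ ω, |f ω| ≤ Mf) (hgb : ∀ ω, |g ω| ≤ Mg) (hf'b : ∀ ω, |f' ω| ≤ Mf') (hg'b : ∀ ω, |g' ω| ≤ Mg')
    (hεf : ∀ ω, |f ω - f' ω| ≤ εf) (hεg : ∀ ω, |g ω - g' ω| ≤ εg) :
    |cov[f, g; μ] - cov[f', g'; μ]| ≤ 2 * εf * Mg + 2 * Mf' * εg := by
  have lf := memLp_two_of_abs_le (μ := μ) hf hfb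
  have lg := memLp_two_of_abs_le (μ := μ) hg hgb
  have lf' := memLp_two_of_abs_le (μ := μ) hf' hf'b
  have lg' := memLp_two_of_abs_le (μ := μ) hg' hg'b
  have hsplit : cov[f, g; μ] - cov[f', g'; μ] = cov[f - f', g; μ] + cov[f', g - g'; μ] := by
    rw [covariance_sub_left lf lf' lg, covariance_sub_right lf' lg lg']; ring
  rw [hsplit]
  have h1 : |cov[f - f', g; μ]| ≤ 2 * εf * Mg :=
    abs_covariance_le_of_bounds (hf.sub hf') hg (fun ω => by simpa using hεf ω) hgb
  have h2 : |cov[f', g - g'; μ]| ≤ 2 * Mf' * εg := by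
    rw [covariance_comm]
    have := abs_covariance_le_of_bounds (μ := μ) (hg.sub hg') hf' (fun ω => by simpa using hεg ω) hf'b
    calc |cov[g - g', f'; μ]| ≤ 2 * εg * Mf' := this
      _ = 2 * Mf' * εg := by ring
  exact (abs_add_le _ _).trans (add_le_add h1 h2)

/-- **Multiscale (martingale) form of the split — iterating `covariance_split` along a tower of block maps.**
`P j : Ω → Ω' j` is the `j`-fold block field read on the fine space, `f j ∘ P j` a version of `E_μ[A | P j]` organised as
a tower: `f (j+1) ∘ P (j+1)` is a block version of `f j ∘ P j` through `P (j+1)` (tower property of conditional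
expectations along successively coarser blockings).  Then for every `k`
`cov_μ[f₀∘Π₀, g₀∘Π₀] = Σ_{j<k} cov_μ[D_j f, D_j g] + cov_{(P_k)_*μ}[f_k, g_k]`, `D_j f = f_j∘P_j − f_{j+1}∘P_{j+1}` the
scale-`j` fluctuation (martingale difference).  With `P 0 = id`, `f 0 = A` this is the fine covariance; the `j`-th
term is a ONE-STEP conditional-fluctuation covariance under the `j`-th effective measure — the currency of a per-step
T1 with hyperscaling constants (memo §4b). -/
theorem covariance_tower_split [IsProbabilityMeasure μ] (Ω' : ℕ → Type*) [∀ j, MeasurableSpace (Ω' j)]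
    (P : ∀ j, Ω → Ω' j) (hP : ∀ j, Measurable (P j)) (f g : ∀ j, Ω' j → ℝ) (hf : ∀ j, Measurable (f j))
    (hg : ∀ j, Measurable (g j)) {Mf Mg : ℝ} (hfb : ∀ j x, |f j x| ≤ Mf) (hgb : ∀ j x, |g j x| ≤ Mg)
    (htf : ∀ j, IsBlockVersion μ (P (j + 1)) (fun ω => f j (P j ω)) (f (j + 1)))
    (htg : ∀ j, IsBlockVersion μ (P (j + 1)) (fun ω => g j (P j ω)) (g (j + 1))) (k : ℕ) :
    cov[fun ω => f 0 (P 0 ω), fun ω => g 0 (P 0 ω); μ] =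
      (∑ j ∈ Finset.range k, cov[fun ω => f j (P j ω) - f (j + 1) (P (j + 1) ω),
          fun ω => g j (P j ω) - g (j + 1) (P (j + 1) ω); μ]) +
        cov[f k, g k; μ.map (P k)] := by
  induction k with
  | zero =>
    rw [Finset.sum_range_zero, zero_add]
    exact (covariance_map_fun (hf 0).aestronglyMeasurable (hg 0).aestronglyMeasurable (hP 0).aemeasurable).symm
  | succ k ih =>
    rw [ih, Finset.sum_range_succ, add_assoc]
    congr 1
    -- one more level: split the level-`k` block covariance through `Π (k+1)`
    have hk : cov[f k, g k; μ.map (P k)] = cov[fun ω => f k (P k ω), fun ω => g k (P k ω); μ] :=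
      covariance_map_fun (hf k).aestronglyMeasurable (hg k).aestronglyMeasurable (hP k).aemeasurable
    rw [hk]
    exact covariance_split (hP (k + 1)) ((hf k).comp (hP k)) ((hg k).comp (hP k)) (hf (k + 1)) (hg (k + 1))
      (fun ω => hfb k _) (fun ω => hgb k _) (hfb (k + 1)) (hgb (k + 1)) (htf k) (htg k)

end Abstract

/-! ## §B  The block map pushes the fine Wilson state to the blocked Gibbs state -/

section Block

variable {d N : ℕ} {G : Type*} [Group G] [MeasurableSpace G] [TopologicalSpace G] [IsTopologicalGroup G]
  [CompactSpace G] [BorelSpace G] {b S c : ℕ} [NeZero b] [NeZero S] (ρ : G →* Matrix (Fin N) (Fin N) ℂ)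
  {B : GaugeBlockAveraging d G b S} {β : ℝ} {𝓔 : BalabanEffectiveAction d S G c}

/-- Un-normalised form: `T_B(e^{-β S_W} dU) = e^{-𝓔} dV` read as `(wilsonWeight).map B.link = 𝓔.terms.weight 𝓔.β`. -/
theorem map_link_wilsonWeight (h : IsBalabanEffectiveActionOf ρ B β 𝓔) :
    (wilsonWeight (d := d) (L := b * S) ρ β).map B.link = 𝓔.terms.weight ρ 𝓔.β := by
  have h' := h
  rw [IsBalabanEffectiveActionOf, GaugeBlockAveraging.IsBlockingOf, GaugeBlockAveraging.blockedWeight,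
    withDensity_perturbedWilsonDensity_zero, BalabanEffectiveAction.density_eq_perturbedWilsonDensity] at h'
  exact h'.trans (withDensity_perturbedWilsonDensity_total ρ 𝓔.β 𝓔.terms)

/-- Blocking loses no mass: the effective partition function is the fine Wilson partition function. -/
theorem partitionFunction_terms_eq (h : IsBalabanEffectiveActionOf ρ B β 𝓔) :
    𝓔.terms.partitionFunction ρ 𝓔.β = partitionFunction (d := d) (L := b * S) ρ β := by
  rw [QuasiLocalGaugePerturbation.partitionFunction, ← map_link_wilsonWeight ρ h,
    Measure.map_apply B.measurable_link MeasurableSet.univ, Set.preimage_univ]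
  rfl

/-- **The block map pushes the fine Wilson PROBABILITY measure forward to the perturbed (Gibbs) measure of the
effective action**: `(μ_{β, bS}) ∘ B.link⁻¹ = μ_{𝓔.β, 𝓔.terms, S}`. -/
theorem map_link_wilsonMeasure (h : IsBalabanEffectiveActionOf ρ B β 𝓔) :
    (wilsonMeasure (d := d) (L := b * S) ρ β).map B.link = 𝓔.terms.perturbedMeasure ρ 𝓔.β := by
  rw [wilsonMeasure, Measure.map_smul, map_link_wilsonWeight ρ h, QuasiLocalGaugePerturbation.perturbedMeasure,
    partitionFunction_terms_eq ρ h]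

/-- Hence the blocked theory is a probability measure as soon as the fine Wilson state is (continuous `ρ`). -/
theorem isProbabilityMeasure_perturbedMeasure_of (hρ : Continuous ρ) (h : IsBalabanEffectiveActionOf ρ B β 𝓔) :
    IsProbabilityMeasure (𝓔.terms.perturbedMeasure ρ 𝓔.β) := by
  rw [← map_link_wilsonMeasure ρ h]
  haveI := isProbabilityMeasure_wilsonMeasure (d := d) (L := b * S) ρ hρ β
  exact Measure.isProbabilityMeasure_map B.measurable_link.aemeasurable

/-- **Block observables**: the fine covariance of two cylinder observables OF THE BLOCK FIELD is their covariance
in the blocked theory — `cov_{β,bS}[f∘B.link, g∘B.link] = cov_{𝓔}[f, g]` (g2 NEXT (2), exact). -/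
theorem covariance_comp_link (h : IsBalabanEffectiveActionOf ρ B β 𝓔) {f g : GaugeConfig d S G → ℝ}
    (hf : Measurable f) (hg : Measurable g) :
    cov[fun U => f (B.link U), fun U => g (B.link U); wilsonMeasure (d := d) (L := b * S) ρ β] =
      cov[f, g; 𝓔.terms.perturbedMeasure ρ 𝓔.β] := by
  rw [← map_link_wilsonMeasure ρ h]
  exact (covariance_map_fun hf.aestronglyMeasurable hg.aestronglyMeasurable B.measurable_link.aemeasurable).symm

end Block

/-! ## §C  The transport inequality on one fine torus -/

section TransportIneq

variable {d N : ℕ} {b S : ℕ} [NeZero b] [NeZero S]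

/-- **TRANSPORT INEQUALITY** (one fine torus of side `b·S`, gauge group `SU(N)`, fundamental Wilson action).
Data: an effective action `𝓔` of lattice Yang–Mills at `β` blocked through `B` which CLUSTERS with `(A_cl, m)`
in block units (at the SU(2) door: the tree row, `A_cl = 16 e^{1/50}`, `m = 1/100`); bounded measurable fine
observables `A, Bo` with block versions `f_A, f_B` (conditional expectations given the block field);
(T1) a bound `ε₁` on the covariance of the fluctuation parts; (T2) finite-range bounded Lipschitz cylinder
approximants `g_A, g_B` of `f_A, f_B` within `ε_A, ε_B` in sup norm, supported on link sets `Δ_A, Δ_B` at block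
distance `≥ n`.  Conclusion:
`|cov_{β,bS}[A, Bo]| ≤ ε₁ + (2 ε_A M_{fB} + 2 M_{gA} ε_B) + A_cl (Σ_{Δ_B} δ_B)(Σ_{Δ_A} δ_A) e^{−m n}`. -/
theorem transport_inequality {B : GaugeBlockAveraging d (SUN N) b S} {β : ℝ}
    {𝓔 : BalabanEffectiveAction d S (SUN N) 1}
    (h𝓔 : IsBalabanEffectiveActionOf (fundamentalRep (Fin N)) B β 𝓔) {Acl m : ℝ}
    (hcl : ClustersWith 𝓔.terms 𝓔.β Acl m)
    {A Bo : GaugeConfig d (b * S) (SUN N) → ℝ} {fA fB gA gB : GaugeConfig d S (SUN N) → ℝ}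
    (hAm : Measurable A) (hBm : Measurable Bo) (hfAm : Measurable fA) (hfBm : Measurable fB)
    (hgAm : Measurable gA) (hgBm : Measurable gB) {MA MB MfA MfB MgA MgB : ℝ} (hAb : ∀ U, |A U| ≤ MA)
    (hBb : ∀ U, |Bo U| ≤ MB) (hfAb : ∀ V, |fA V| ≤ MfA) (hfBb : ∀ V, |fB V| ≤ MfB) (hgAb : ∀ V, |gA V| ≤ MgA)
    (hgBb : ∀ V, |gB V| ≤ MgB)
    (hvA : IsBlockVersion (wilsonMeasure (d := d) (L := b * S) (fundamentalRep (Fin N)) β) B.link A fA)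
    (hvB : IsBlockVersion (wilsonMeasure (d := d) (L := b * S) (fundamentalRep (Fin N)) β) B.link Bo fB)
    {ε₁ : ℝ} (hT1 : |cov[fun U => A U - fA (B.link U), fun U => Bo U - fB (B.link U);
      wilsonMeasure (d := d) (L := b * S) (fundamentalRep (Fin N)) β]| ≤ ε₁)
    {εA εB : ℝ} (hεA : ∀ V, |fA V - gA V| ≤ εA) (hεB : ∀ V, |fB V - gB V| ≤ εB)
    {ΔA ΔB : Finset (Edge d S)} (hgAdep : DependsOn gA (↑ΔA : Set (Edge d S)))
    (hgBdep : DependsOn gB (↑ΔB : Set (Edge d S))) {δA δB : Edge d S → ℝ} (hδA : IsLipBound suFrobDist gA δA)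
    (hδB : IsLipBound suFrobDist gB δB) {n : ℕ}
    (hsep : ∀ x ∈ ΔA, ∀ y ∈ ΔB, n ≤ Literature.MathematicalPhysics.QuantumFieldTheory.torusNorm (x.1 - y.1)) :
    |cov[A, Bo; wilsonMeasure (d := d) (L := b * S) (fundamentalRep (Fin N)) β]| ≤
      ε₁ + (2 * εA * MfB + 2 * MgA * εB) + Acl * (∑ y ∈ ΔB, δB y) * (∑ x ∈ ΔA, δA x) * Real.exp (-m * n) := by
  set μ := wilsonMeasure (d := d) (L := b * S) (fundamentalRep (Fin N)) β with hμ
  haveI : IsProbabilityMeasure μ :=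
    isProbabilityMeasure_wilsonMeasure (d := d) (L := b * S) _ (continuous_fundamentalRep (Fin N)) β
  haveI : IsProbabilityMeasure (𝓔.terms.perturbedMeasure (fundamentalRep (Fin N)) 𝓔.β) :=
    isProbabilityMeasure_perturbedMeasure_of _ (continuous_fundamentalRep (Fin N)) h𝓔
  -- (1) total covariance through the block map
  have hsplit := covariance_split (μ := μ) B.measurable_link hAm hBm hfAm hfBm hAb hBb hfAb hfBb hvA hvB
  -- (2) the block term lives in the blocked Gibbs state
  have hblock : cov[fA, fB; μ.map B.link] = cov[fA, fB; 𝓔.terms.perturbedMeasure (fundamentalRep (Fin N)) 𝓔.β] := by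
    rw [hμ, map_link_wilsonMeasure _ h𝓔]
  -- (3) approximation by finite-range cylinder observables
  have happrox := abs_covariance_sub_covariance_le
    (μ := 𝓔.terms.perturbedMeasure (fundamentalRep (Fin N)) 𝓔.β) hfAm hfBm hgAm hgBm hfAb hfBb hgAb hgBb hεA hεB
  -- (4) the door: clustering of the blocked theory
  have hdoor := hcl gA gB ΔA ΔB δA δB n hgAm hgBm hgAdep hgBdep ⟨MgA, hgAb⟩ ⟨MgB, hgBb⟩ hδA hδB hsep
  -- assemble
  rw [hsplit, hblock]
  have key : |cov[fA, fB; 𝓔.terms.perturbedMeasure (fundamentalRep (Fin N)) 𝓔.β]| ≤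
      (2 * εA * MfB + 2 * MgA * εB) + Acl * (∑ y ∈ ΔB, δB y) * (∑ x ∈ ΔA, δA x) * Real.exp (-m * n) := by
    have := abs_sub_abs_le_abs_sub (cov[fA, fB; 𝓔.terms.perturbedMeasure (fundamentalRep (Fin N)) 𝓔.β])
      (cov[gA, gB; 𝓔.terms.perturbedMeasure (fundamentalRep (Fin N)) 𝓔.β])
    linarith
  calc _ ≤ |cov[fun U => A U - fA (B.link U), fun U => Bo U - fB (B.link U); μ]| +
        |cov[fA, fB; 𝓔.terms.perturbedMeasure (fundamentalRep (Fin N)) 𝓔.β]| := abs_add_le _ _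
    _ ≤ _ := by linarith

end TransportIneq

end Summit.Ventures.YMGap.YM4Door

end
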